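import Literature.AlgebraicGeometry.AbelianSchemes.AbelianVarietyCechProductMaps
import Literature.AlgebraicGeometry.Modules.CechRefineClasses
import Literature.AlgebraicGeometry.Modules.CechPullbackMultiplicative
import Literature.Algebra.Homology.OrderedCechSystemRefineHomotopy
import Literature.AlgebraicGeometry.AbelianSchemes.AbelianSchemeQuotientMulNDescent
import HarnessLib

/-!
# The diagonal Čech cover of an abelian variety and the maps `Δ^*`, `[2]^*`, `ref` on ordered Čech classes of `𝒪` (Mumford AV §13)

Layer `Literature/AlgebraicGeometry/AbelianSchemes`; namespace `Literature.AlgebraicGeometry.AbelianSchemes.AbelianVarietyCech`.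
DEFINITION file (reducible abbreviations naming maps built from ★ data, one auxiliary `def ψΔ`, and theorems; no instance, no
notation, no named fact, no `sorry`).  Cell `hodgecm-mathlib` FLOOR 0, F-11 sub-line P1b, MONO-G1 slot (5) `hrel₃` road (R109),
piece **N1a** (F0P1b-p01 (g2)); sequel **N1b** `AbelianVarietyCechMulTwo` proves `[2]^* = 2` on `Ȟ¹` and `= 4` on `Ȟ²` over it;
consumer N4 `AbelianVarietyCechH2MulTwoRaw` (F0P1b-p04 (g2)).  Everything over ★ `AbelianVarietyCechProductMaps` (F0P1b-p02 (g2):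
the covers `U`, `W₀`, `W`, the complexes `CA CS CT`, the maps `pOne pTwo mT rT …` as binders∕abbreviations), ★ `Modules/CechRefineClasses`
(class-level tools), ★ `Modules/CechPullbackMultiplicative`, ★ `OrderedCechSystemRefineHomotopy` (index-map independence).

For the abelian variety `A` over a field `k`, `[2] := A.mulN 2 = Δ ≫ m` (`Δ = (𝟙, 𝟙)` the diagonal; `mulN 2 = 𝟙 * 𝟙 = lift 𝟙 𝟙 ≫ μ`).
The DIAGONAL COVER of `A` attached to a finite affine cover `U` is a binder `WΔ : (ι ×ₗ ι) ×ₗ ι → A.X.left.affineOpens` with shape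
`hWΔ : WΔ ((i, j), l) = U_i ∩ U_j ∩ [2]⁻¹ U_l` (`= Δ⁻¹ W ((i, j), l)`; `exists_diagCover` constructs it from separatedness alone,
`iSup_diagCover_eq_top` says it covers).  On it we read `ΔT = Δ^* : Ȟ(W) → Ȟ(WΔ)` (identity index map), `twoΔ = [2]^* : Ȟ(U) → Ȟ(WΔ)`
(index map `((i,j),l) ↦ l`) and the refinements `refΔ₁`, `refΔ₂ : Ȟ(U) → Ȟ(WΔ)` (index maps `((i,j),l) ↦ i`, `↦ j`), and prove:

* §1 `diag_p₁`, `diag_p₂`, **`diag_m : Δ ≫ m = [2]`**, base rings; §2 the diagonal cover and the admissibilities;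
* §3 the composites **`ΔT_mT : Δ^* m_T^* = [2]^*`**, **`ΔT_rT_pOne ∕ ΔT_rT_pTwo : Δ^* r^* pᵢ^* = refᵢ`** (★ `refineCochain_comp`);
* §4 **`refΔ₁_eq_refΔ₂`** (★ `homologyMap_eq_of_refine`, joint restriction datum `ψΔ`);
* §5 `twoΔ_mul`, `refΔ₁_mul` — `[2]^*` (NON-monotone index map) and `ref` are multiplicative on classes (★ `homologyMap_pullback_cupH`);
* §6 `exists_covers` — the auxiliary covers `W₀`, `W` and the index `j₀` exist (★ `Morphisms/ProductAffineCover`).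

## References
* [MumfordAV1970] D. Mumford, *Abelian Varieties* (1970), §13 Cor. 2 (p. 129) and its proof (`n_X = m ∘ Δ`-type factorisations, `n_X^*`).
* [StacksProject] The Stacks Project, Tag 01FP (cup product, functoriality and index-map independence of Čech cohomology), Tag 01FG.
-/

noncomputable section

open CategoryTheory CategoryTheory.Limits CategoryTheory.MonoidalCategory AlgebraicGeometry TopologicalSpace Opposite
open HomologicalComplex TensorProduct Finset
open Literature.Algebra.Homology Literature.Algebra.Homology.OrderedCech Literature.AlgebraicGeometry.Modules
open Literature.AlgebraicGeometry.Morphisms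

set_option backward.isDefEq.respectTransparency false

namespace Literature.AlgebraicGeometry.AbelianSchemes.AbelianVarietyCech

universe u


/-! ## §N1 (F0P1b-p01 (g2)) — `[2]^* = 2` on `Ȟ¹(U, 𝒪_A)` and `[2]^* = 4` on `Ȟ²(U, 𝒪_A)`, read on the DIAGONAL cover
`WΔ ((i, j), l) = U_i ∩ U_j ∩ [2]⁻¹ U_l = Δ⁻¹ W ((i, j), l)` — road: `[2] = Δ ≫ m`, `[2]^* = Δ^* m_T^* = Δ^* r^* m^*`,
primitivity `m^* a = p₁^* a + p₂^* a` in degree one, `Δ^* r^* pᵢ^* = ref`, then degree two by `Ȟ¹ ⊗ Ȟ¹ ↠ Ȟ²` and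
multiplicativity. -/

section MulTwo

variable {k : Type} [Field k] [CharZero k] (A : AbelianSchemeOver (Spec (.of k)))
  {ι : Type} [LinearOrder ι] [Fintype ι] (U : ι → A.X.left.affineOpens) (hcov : ⨆ i, (U i).1 = ⊤)
  (W₀ : ι ×ₗ ι → (X2 A).affineOpens)
  (hW₀ : ∀ i j, (W₀ (toLex (i, j))).1 = p₁ A ⁻¹ᵁ (U i).1 ⊓ p₂ A ⁻¹ᵁ (U j).1)
  (W : (ι ×ₗ ι) ×ₗ ι → (X2 A).affineOpens)
  (hW : ∀ c l, (W (toLex (c, l))).1 = (W₀ c).1 ⊓ m A ⁻¹ᵁ (U l).1)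
  (j₀ : ι) (hj₀ : e A ⁻¹ᵁ (U j₀).1 = ⊤)

/-- the diagonal `Δ = (𝟙, 𝟙) : X → X × X`. [cite: MumfordAV1970, §13 Cor. 2 (p. 129)] -/
abbrev diag : A.X.left ⟶ X2 A := (CartesianMonoidalCategory.lift (𝟙 A.X) (𝟙 A.X)).left
/-- multiplication by two `[2] : X → X` (★ `AbelianSchemeOver.mulN`). [cite: MumfordAV1970, §13 Cor. 2 (p. 129)] -/
abbrev mulTwo : A.X.left ⟶ A.X.left := (A.mulN 2).left

omit [CharZero k] in
/-- `Δ ≫ p₁ = 𝟙`. [cite: MumfordAV1970, §13 Cor. 2 (p. 129)] -/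
theorem diag_p₁ : diag A ≫ p₁ A = 𝟙 _ := by
  rw [← Over.comp_left, CartesianMonoidalCategory.lift_fst]
  rfl

omit [CharZero k] in
/-- `Δ ≫ p₂ = 𝟙`. [cite: MumfordAV1970, §13 Cor. 2 (p. 129)] -/
theorem diag_p₂ : diag A ≫ p₂ A = 𝟙 _ := by
  rw [← Over.comp_left, CartesianMonoidalCategory.lift_snd]
  rfl

omit [CharZero k] in
open scoped MonObj in
/-- `[2] = Δ ≫ m`: `mulN 2 = 𝟙 ^ 2 = 𝟙 * 𝟙 = lift 𝟙 𝟙 ≫ μ`. [cite: MumfordAV1970, §13 Cor. 2 (p. 129)] -/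
theorem diag_m : diag A ≫ m A = mulTwo A := by
  rw [← Over.comp_left, ← Hom.mul_def, ← pow_two]
  rfl

omit [CharZero k] in
/-- Base rings along `Δ`. [cite: StacksProject, Tag 01FP] -/
theorem hρ_diag (a : k) : ρ₁ A a = (diag A).appTop (ρ₂ A a) :=
  scalarRingHomTop_over (CartesianMonoidalCategory.lift (𝟙 A.X) (𝟙 A.X)) a
omit [CharZero k] in
/-- Base rings along `[2]`. [cite: StacksProject, Tag 01FP] -/
theorem hρ_mulTwo (a : k) : ρ₁ A a = (mulTwo A).appTop (ρ₁ A a) := scalarRingHomTop_over (A.mulN 2) a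
omit [CharZero k] in
/-- Base rings along `𝟙`. [cite: StacksProject, Tag 01FP] -/
theorem hρ_one (a : k) : ρ₁ A a = (𝟙 A.X.left : A.X.left ⟶ A.X.left).appTop (ρ₁ A a) := by simp

omit [CharZero k] [Fintype ι] in
/-- **The diagonal cover exists** as a family of affine opens: `U_i ∩ U_j ∩ [2]⁻¹ U_l` is affine (`X` separated over `k`,
★ `isAffineOpen_inf_preimage`). [cite: StacksProject, Tag 01FP] -/
theorem exists_diagCover : ∃ WΔ : (ι ×ₗ ι) ×ₗ ι → A.X.left.affineOpens,
    ∀ i j l, (WΔ (toLex (toLex (i, j), l))).1 = (U i).1 ⊓ (U j).1 ⊓ mulTwo A ⁻¹ᵁ (U l).1 := by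
  classical
  haveI : IsSeparated A.X.hom := A.isProper.toIsSeparated
  haveI := isSeparated_X A
  have hij : ∀ i j : ι, IsAffineOpen ((U i).1 ⊓ (U j).1) := fun i j => by
    have h := isAffineOpen_cechOpen_of_nonempty U (s := {i, j}) ⟨i, Finset.mem_insert_self _ _⟩
    rwa [cechOpen_pair] at h
  exact ⟨fun d => ⟨_, isAffineOpen_inf_preimage (Z := A.X) (mulTwo A) (hij (ofLex (ofLex d).1).1 (ofLex (ofLex d).1).2)
    (U (ofLex d).2)⟩, fun _ _ _ => rfl⟩

variable (WΔ : (ι ×ₗ ι) ×ₗ ι → A.X.left.affineOpens)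
  (hWΔ : ∀ i j l, (WΔ (toLex (toLex (i, j), l))).1 = (U i).1 ⊓ (U j).1 ⊓ mulTwo A ⁻¹ᵁ (U l).1)

/-- The diagonal cover as a family of opens. [cite: StacksProject, Tag 01FP] -/
abbrev WΔ' : (ι ×ₗ ι) ×ₗ ι → A.X.left.Opens := fun d => (WΔ d).1

omit [CharZero k] [LinearOrder ι] [Fintype ι] in
include hWΔ in
/-- The diagonal cover read on a general index. [cite: StacksProject, Tag 01FP] -/
theorem diagCover_eq (d : (ι ×ₗ ι) ×ₗ ι) :
    WΔ' A WΔ d = (U (ofLex (ofLex d).1).1).1 ⊓ (U (ofLex (ofLex d).1).2).1 ⊓ mulTwo A ⁻¹ᵁ (U (ofLex d).2).1 := by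
  obtain ⟨c, l⟩ := d
  obtain ⟨i, j⟩ := c
  exact hWΔ i j l

omit [CharZero k] [LinearOrder ι] [Fintype ι] in
include hWΔ in
/-- `θ_{[2]} ((i, j), l) = l` is admissible: `WΔ ((i, j), l) ⊆ [2]⁻¹ U_l`. [cite: StacksProject, Tag 01FP] -/
theorem adm_mulTwo (d : (ι ×ₗ ι) ×ₗ ι) : WΔ' A WΔ d ≤ mulTwo A ⁻¹ᵁ U' A U (ofLex d).2 := by
  rw [diagCover_eq A U WΔ hWΔ]
  exact inf_le_right

omit [CharZero k] [LinearOrder ι] [Fintype ι] in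
include hWΔ in
/-- `((i, j), l) ↦ i` is admissible for the refinement `WΔ → U`. [cite: StacksProject, Tag 01FP] -/
theorem adm_ref₁ (d : (ι ×ₗ ι) ×ₗ ι) : WΔ' A WΔ d ≤ (𝟙 A.X.left : A.X.left ⟶ A.X.left) ⁻¹ᵁ U' A U (ofLex (ofLex d).1).1 := by
  rw [diagCover_eq A U WΔ hWΔ]
  exact inf_le_left.trans inf_le_left

omit [CharZero k] [LinearOrder ι] [Fintype ι] in
include hWΔ in
/-- `((i, j), l) ↦ j` is admissible for the refinement `WΔ → U`. [cite: StacksProject, Tag 01FP] -/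
theorem adm_ref₂ (d : (ι ×ₗ ι) ×ₗ ι) : WΔ' A WΔ d ≤ (𝟙 A.X.left : A.X.left ⟶ A.X.left) ⁻¹ᵁ U' A U (ofLex (ofLex d).1).2 := by
  rw [diagCover_eq A U WΔ hWΔ]
  exact inf_le_left.trans inf_le_right

omit [CharZero k] [LinearOrder ι] [Fintype ι] in
include hW₀ hW hWΔ in
/-- `WΔ = Δ⁻¹ W` (so the identity index map is admissible for `Δ`). [cite: StacksProject, Tag 01FP] -/
theorem adm_diag (d : (ι ×ₗ ι) ×ₗ ι) : WΔ' A WΔ d ≤ diag A ⁻¹ᵁ W' A W (id d) := by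
  obtain ⟨c, l⟩ := d
  obtain ⟨i, j⟩ := c
  change (WΔ (toLex (toLex (i, j), l))).1 ≤ diag A ⁻¹ᵁ (W (toLex (toLex (i, j), l))).1
  rw [hWΔ, hW, hW₀]
  intro x hx
  change (diag A).base x ∈ (p₁ A ⁻¹ᵁ (U i).1 ⊓ p₂ A ⁻¹ᵁ (U j).1) ⊓ m A ⁻¹ᵁ (U l).1
  refine ⟨⟨?_, ?_⟩, ?_⟩
  · change (p₁ A).base ((diag A).base x) ∈ (U i).1
    rw [AbelianSchemeOver.mem_preimage_of_comp_eq (diag_p₁ A) (U i).1 x]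
    exact hx.1.1
  · change (p₂ A).base ((diag A).base x) ∈ (U j).1
    rw [AbelianSchemeOver.mem_preimage_of_comp_eq (diag_p₂ A) (U j).1 x]
    exact hx.1.2
  · change (m A).base ((diag A).base x) ∈ (U l).1
    rw [AbelianSchemeOver.mem_preimage_of_comp_eq (diag_m A) (U l).1 x]
    exact hx.2

omit [CharZero k] [LinearOrder ι] [Fintype ι] in
include hcov hWΔ in
/-- **The diagonal cover covers `X`**: `x ∈ U_i` and `[2] x ∈ U_l` give `x ∈ WΔ ((i, i), l)`. [cite: StacksProject, Tag 01FP] -/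
theorem iSup_diagCover_eq_top : ⨆ d, WΔ' A WΔ d = ⊤ := by
  refine top_le_iff.mp fun x _ => ?_
  have hx : x ∈ (⊤ : A.X.left.Opens) := trivial
  have hy : (mulTwo A).base x ∈ (⊤ : A.X.left.Opens) := trivial
  rw [← hcov] at hx hy
  obtain ⟨i, hi⟩ := Opens.mem_iSup.mp hx
  obtain ⟨l, hl⟩ := Opens.mem_iSup.mp hy
  refine Opens.mem_iSup.mpr ⟨toLex (toLex (i, i), l), ?_⟩
  change x ∈ (WΔ (toLex (toLex (i, i), l))).1
  rw [hWΔ]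
  exact ⟨⟨hi, hi⟩, hl⟩

/-! ### The Čech data on the diagonal cover -/

/-- `Č(WΔ, 𝒪_X)`. [cite: MumfordAV1970, §13 Cor. 2 (p. 129)] -/
abbrev CΔ := cechComplex (WΔ' A WΔ) (unitModule A.X.left) (ρ₁ A)
/-- cup product on `Ȟ(WΔ, 𝒪_X)`. [cite: MumfordAV1970, §13 Cor. 2 (p. 129)] -/
abbrev cupΔ (a b n : ℕ) (h : a + b = n) :=
  cupH (mulPairing (WΔ' A WΔ) (ρ₁ A)) (isNaturalPairing_mulPairing _ _) a b n h

/-- `φ_Δ` (identity index map). [cite: StacksProject, Tag 01FP] -/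
abbrev φdiag := pullbackSystemHom (diag A) (W' A W) (WΔ' A WΔ) id (adm_diag A U W₀ hW₀ W hW WΔ hWΔ) (ρ₂ A) (ρ₁ A) (hρ_diag A)
/-- `φ_{[2]}` (index map `((i, j), l) ↦ l`). [cite: StacksProject, Tag 01FP] -/
abbrev φmulTwo := pullbackSystemHom (mulTwo A) (U' A U) (WΔ' A WΔ) (fun d => (ofLex d).2) (adm_mulTwo A U WΔ hWΔ) (ρ₁ A) (ρ₁ A)
  (hρ_mulTwo A)
/-- `φ_{ref₁}` (refinement `WΔ → U` along `((i, j), l) ↦ i`). [cite: StacksProject, Tag 01FP] -/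
abbrev φref₁ := pullbackSystemHom (𝟙 A.X.left) (U' A U) (WΔ' A WΔ) (fun d => (ofLex (ofLex d).1).1)
  (adm_ref₁ A U WΔ hWΔ) (ρ₁ A) (ρ₁ A) (hρ_one A)
/-- `φ_{ref₂}` (refinement `WΔ → U` along `((i, j), l) ↦ j`). [cite: StacksProject, Tag 01FP] -/
abbrev φref₂ := pullbackSystemHom (𝟙 A.X.left) (U' A U) (WΔ' A WΔ) (fun d => (ofLex (ofLex d).1).2)
  (adm_ref₂ A U WΔ hWΔ) (ρ₁ A) (ρ₁ A) (hρ_one A)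

/-- `Δ^* : Ȟ(W) → Ȟ(WΔ)`. [cite: MumfordAV1970, §13 Cor. 2 (p. 129)] -/
abbrev ΔT (n : ℕ) : (CT A W).homology (n : ℤ) →ₗ[k] (CΔ A WΔ).homology (n : ℤ) :=
  (HomologicalComplex.homologyMap (refineComplexMap id (φdiag A U W₀ hW₀ W hW WΔ hWΔ)) (n : ℤ)).hom
/-- `[2]^* : Ȟ(U) → Ȟ(WΔ)` along `((i, j), l) ↦ l`. [cite: MumfordAV1970, §13 Cor. 2 (p. 129)] -/
abbrev twoΔ (n : ℕ) : (CA A U).homology (n : ℤ) →ₗ[k] (CΔ A WΔ).homology (n : ℤ) :=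
  (HomologicalComplex.homologyMap (refineComplexMap (fun d => (ofLex d).2) (φmulTwo A U WΔ hWΔ)) (n : ℤ)).hom
/-- `ref₁ : Ȟ(U) → Ȟ(WΔ)` along `((i, j), l) ↦ i`. [cite: MumfordAV1970, §13 Cor. 2 (p. 129)] -/
abbrev refΔ₁ (n : ℕ) : (CA A U).homology (n : ℤ) →ₗ[k] (CΔ A WΔ).homology (n : ℤ) :=
  (HomologicalComplex.homologyMap (refineComplexMap (fun d => (ofLex (ofLex d).1).1) (φref₁ A U WΔ hWΔ)) (n : ℤ)).hom
/-- `ref₂ : Ȟ(U) → Ȟ(WΔ)` along `((i, j), l) ↦ j`. [cite: MumfordAV1970, §13 Cor. 2 (p. 129)] -/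
abbrev refΔ₂ (n : ℕ) : (CA A U).homology (n : ℤ) →ₗ[k] (CΔ A WΔ).homology (n : ℤ) :=
  (HomologicalComplex.homologyMap (refineComplexMap (fun d => (ofLex (ofLex d).1).2) (φref₂ A U WΔ hWΔ)) (n : ℤ)).hom

/-! ### The composites `Δ^* m_T^* = [2]^*`, `Δ^* r^* p₁^* = ref₁`, `Δ^* r^* p₂^* = ref₂` -/

omit [CharZero k] [Fintype ι] in
include hW₀ in
/-- `Δ^* ∘ m_T^* = [2]^*` (`Δ ≫ m = [2]`, composite index map `((i,j),l) ↦ l`). [cite: StacksProject, Tag 01FP] -/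
theorem ΔT_mT (n : ℕ) (y : (CA A U).homology (n : ℤ)) :
    ΔT A U W₀ hW₀ W hW WΔ hWΔ n (mT A U W₀ W hW n y) = twoΔ A U WΔ hWΔ n y := by
  rw [homologyMap_comp_apply]
  have hadm := adm_comp _ _ _ _ _ _ _ (AbelianSchemeOver.refinedCover_le_preimage_mul A (U' A U) (W₀' A W₀) (W' A W) hW)
    (adm_diag A U W₀ hW₀ W hW WΔ hWΔ)
  have hρc := hρ_comp _ _ (ρ₁ A) (ρ₂ A) (ρ₁ A) (hρ_m A) (hρ_diag A)
  have hF : refineComplexMap _ (φm A U W₀ W hW) ≫ refineComplexMap _ (φdiag A U W₀ hW₀ W hW WΔ hWΔ) =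
      refineComplexMap _ (φmulTwo A U WΔ hWΔ) := by
    refine hom_ext_apply fun m' g => ?_
    change refineCochain _ (φdiag A U W₀ hW₀ W hW WΔ hWΔ) m' (refineCochain _ (φm A U W₀ W hW) m' g) =
      refineCochain _ (φmulTwo A U WΔ hWΔ) m' g
    rw [refineCochain_comp _ _ _ _ (pullbackSystemHom (diag A ≫ m A) (U' A U) (WΔ' A WΔ) _ hadm (ρ₁ A) (ρ₁ A) hρc)
        (pullbackSystemHom_comp_app _ _ _ _ _ _ _ _ _ _ _ _ _ _ _ _)]
    funext σ'
    rw [refineCochain_apply, refineCochain_apply]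
    exact pullbackSystemHom_congr (diag_m A) (U' A U) (WΔ' A WΔ) _ hadm (adm_mulTwo A U WΔ hWΔ) (ρ₁ A) (ρ₁ A) hρc
      (hρ_mulTwo A) σ'.1 _
  rw [hF]

omit [CharZero k] [Fintype ι] in
include hW₀ in
/-- `Δ^* ∘ r^* ∘ p₁^* = ref₁` (`Δ ≫ 𝟙 ≫ p₁ = 𝟙`, composite index map `((i,j),l) ↦ i`). [cite: StacksProject, Tag 01FP] -/
theorem ΔT_rT_pOne (n : ℕ) (y : (CA A U).homology (n : ℤ)) :
    ΔT A U W₀ hW₀ W hW WΔ hWΔ n (rT A U W₀ W hW n (pOne A U W₀ hW₀ n y)) = refΔ₁ A U WΔ hWΔ n y := by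
  rw [homologyMap_comp_apply, homologyMap_comp_apply]
  -- the inner composite `p₁ ∘ r`
  have hadm₁ := adm_comp _ _ _ _ _ _ _ (AbelianSchemeOver.productCover_le_preimage_fst A (U' A U) (W₀' A W₀) hW₀)
    (AbelianSchemeOver.refinedCover_le_productCover A (U' A U) (W₀' A W₀) (W' A W) hW)
  have hρc₁ := hρ_comp _ _ (ρ₁ A) (ρ₂ A) (ρ₂ A) (hρ_p₁ A) (hρ_r A)
  -- the full composite
  have hadm₂ := adm_comp _ _ _ _ _ _ _ hadm₁ (adm_diag A U W₀ hW₀ W hW WΔ hWΔ)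
  have hρc₂ := hρ_comp _ _ (ρ₁ A) (ρ₂ A) (ρ₁ A) hρc₁ (hρ_diag A)
  have hF : refineComplexMap _ (φp₁ A U W₀ hW₀) ≫ refineComplexMap _ (φr A U W₀ W hW) ≫
      refineComplexMap _ (φdiag A U W₀ hW₀ W hW WΔ hWΔ) = refineComplexMap _ (φref₁ A U WΔ hWΔ) := by
    refine hom_ext_apply fun m' g => ?_
    change refineCochain _ (φdiag A U W₀ hW₀ W hW WΔ hWΔ) m'
      (refineCochain _ (φr A U W₀ W hW) m' (refineCochain _ (φp₁ A U W₀ hW₀) m' g)) =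
      refineCochain _ (φref₁ A U WΔ hWΔ) m' g
    rw [refineCochain_comp _ _ _ _ (pullbackSystemHom (𝟙 _ ≫ p₁ A) (U' A U) (W' A W) _ hadm₁ (ρ₁ A) (ρ₂ A) hρc₁)
        (pullbackSystemHom_comp_app _ _ _ _ _ _ _ _ _ _ _ _ _ _ _ _),
      refineCochain_comp _ _ _ _ (pullbackSystemHom (diag A ≫ 𝟙 _ ≫ p₁ A) (U' A U) (WΔ' A WΔ) _ hadm₂ (ρ₁ A) (ρ₁ A) hρc₂)
        (pullbackSystemHom_comp_app _ _ _ _ _ _ _ _ _ _ _ _ _ _ _ _)]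
    funext σ'
    rw [refineCochain_apply, refineCochain_apply]
    have e : diag A ≫ 𝟙 _ ≫ p₁ A = 𝟙 _ := by rw [Category.id_comp, diag_p₁]
    exact pullbackSystemHom_congr e (U' A U) (WΔ' A WΔ) _ hadm₂ (adm_ref₁ A U WΔ hWΔ) (ρ₁ A) (ρ₁ A) hρc₂
      (hρ_one A) σ'.1 _
  rw [hF]

omit [CharZero k] [Fintype ι] in
include hW₀ in
/-- `Δ^* ∘ r^* ∘ p₂^* = ref₂` (`Δ ≫ 𝟙 ≫ p₂ = 𝟙`, composite index map `((i,j),l) ↦ j`). [cite: StacksProject, Tag 01FP] -/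
theorem ΔT_rT_pTwo (n : ℕ) (y : (CA A U).homology (n : ℤ)) :
    ΔT A U W₀ hW₀ W hW WΔ hWΔ n (rT A U W₀ W hW n (pTwo A U W₀ hW₀ n y)) = refΔ₂ A U WΔ hWΔ n y := by
  rw [homologyMap_comp_apply, homologyMap_comp_apply]
  have hadm₁ := adm_comp _ _ _ _ _ _ _ (AbelianSchemeOver.productCover_le_preimage_snd A (U' A U) (W₀' A W₀) hW₀)
    (AbelianSchemeOver.refinedCover_le_productCover A (U' A U) (W₀' A W₀) (W' A W) hW)
  have hρc₁ := hρ_comp _ _ (ρ₁ A) (ρ₂ A) (ρ₂ A) (hρ_p₂ A) (hρ_r A)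
  have hadm₂ := adm_comp _ _ _ _ _ _ _ hadm₁ (adm_diag A U W₀ hW₀ W hW WΔ hWΔ)
  have hρc₂ := hρ_comp _ _ (ρ₁ A) (ρ₂ A) (ρ₁ A) hρc₁ (hρ_diag A)
  have hF : refineComplexMap _ (φp₂ A U W₀ hW₀) ≫ refineComplexMap _ (φr A U W₀ W hW) ≫
      refineComplexMap _ (φdiag A U W₀ hW₀ W hW WΔ hWΔ) = refineComplexMap _ (φref₂ A U WΔ hWΔ) := by
    refine hom_ext_apply fun m' g => ?_
    change refineCochain _ (φdiag A U W₀ hW₀ W hW WΔ hWΔ) m'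
      (refineCochain _ (φr A U W₀ W hW) m' (refineCochain _ (φp₂ A U W₀ hW₀) m' g)) =
      refineCochain _ (φref₂ A U WΔ hWΔ) m' g
    rw [refineCochain_comp _ _ _ _ (pullbackSystemHom (𝟙 _ ≫ p₂ A) (U' A U) (W' A W) _ hadm₁ (ρ₁ A) (ρ₂ A) hρc₁)
        (pullbackSystemHom_comp_app _ _ _ _ _ _ _ _ _ _ _ _ _ _ _ _),
      refineCochain_comp _ _ _ _ (pullbackSystemHom (diag A ≫ 𝟙 _ ≫ p₂ A) (U' A U) (WΔ' A WΔ) _ hadm₂ (ρ₁ A) (ρ₁ A) hρc₂)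
        (pullbackSystemHom_comp_app _ _ _ _ _ _ _ _ _ _ _ _ _ _ _ _)]
    funext σ'
    rw [refineCochain_apply, refineCochain_apply]
    have e : diag A ≫ 𝟙 _ ≫ p₂ A = 𝟙 _ := by rw [Category.id_comp, diag_p₂]
    exact pullbackSystemHom_congr e (U' A U) (WΔ' A WΔ) _ hadm₂ (adm_ref₂ A U WΔ hWΔ) (ρ₁ A) (ρ₁ A) hρc₂
      (hρ_one A) σ'.1 _
  rw [hF]

/-! ### `ref₁ = ref₂` on classes (★ B-p10 `homologyMap_eq_of_refine`: index-map independence) -/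

omit [CharZero k] [Fintype ι] in
include hWΔ in
/-- `WΔ d ⊆ U_i ∩ U_j`: the joint admissibility for the prism between `ref₁` and `ref₂`. [cite: MumfordAV1970, §13 Cor. 2 (p. 129)] -/
theorem diagCover_le_cechOpen_union (s' : Finset ((ι ×ₗ ι) ×ₗ ι)) :
    cechOpen (WΔ' A WΔ) s' ≤ cechOpen (U' A U)
      (s'.image (fun d => (ofLex (ofLex d).1).1) ∪ s'.image (fun d => (ofLex (ofLex d).1).2)) := by
  classical
  refine Finset.le_inf fun i hi => ?_
  rcases Finset.mem_union.mp hi with h | h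
  · obtain ⟨d, hd, rfl⟩ := Finset.mem_image.mp h
    exact (cechOpen_le (WΔ' A WΔ) hd).trans (adm_ref₁ A U WΔ hWΔ d)
  · obtain ⟨d, hd, rfl⟩ := Finset.mem_image.mp h
    exact (cechOpen_le (WΔ' A WΔ) hd).trans (adm_ref₂ A U WΔ hWΔ d)

/-- The joint restriction datum `Γ(𝒪, U_{θ₁ s' ∪ θ₂ s'}) → Γ(𝒪, WΔ_{s'})` of the prism between `ref₁` and `ref₂`. [cite: StacksProject, Tag 01FP] -/
def ψΔ (s' : Finset ((ι ×ₗ ι) ×ₗ ι)) :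
    (sectionsSystem (U' A U) (unitModule A.X.left) (ρ₁ A)).obj
        (s'.image (fun d : (ι ×ₗ ι) ×ₗ ι => (ofLex (ofLex d).1).1) ∪
          s'.image (fun d : (ι ×ₗ ι) ×ₗ ι => (ofLex (ofLex d).1).2)) ⟶
      (sectionsSystem (WΔ' A WΔ) (unitModule A.X.left) (ρ₁ A)).obj s' :=
  ModuleCat.ofHom (SecMod.res (unitModule A.X.left) (ρ₁ A) (diagCover_le_cechOpen_union A U WΔ hWΔ s'))

omit [CharZero k] [Fintype ι] in
/-- Unfolding of `ψΔ`. [cite: MumfordAV1970, §13 Cor. 2 (p. 129)] -/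
theorem ψΔ_apply (s' : Finset ((ι ×ₗ ι) ×ₗ ι)) (x : SecMod (unitModule A.X.left) (ρ₁ A) (cechOpen (U' A U)
      (s'.image (fun d : (ι ×ₗ ι) ×ₗ ι => (ofLex (ofLex d).1).1) ∪
        s'.image (fun d : (ι ×ₗ ι) ×ₗ ι => (ofLex (ofLex d).1).2)))) :
    (ψΔ A U WΔ hWΔ s').hom x = SecMod.res (unitModule A.X.left) (ρ₁ A) (diagCover_le_cechOpen_union A U WΔ hWΔ s') x :=
  rfl

omit [CharZero k] [Fintype ι] in
/-- `ψΔ` is natural (restrictions compose). [cite: StacksProject, Tag 01FP] -/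
theorem ψΔ_naturality ⦃s' t' : Finset ((ι ×ₗ ι) ×ₗ ι)⦄ (hst : s' ⊆ t')
    (x : SecMod (unitModule A.X.left) (ρ₁ A) (cechOpen (U' A U)
      (s'.image (fun d : (ι ×ₗ ι) ×ₗ ι => (ofLex (ofLex d).1).1) ∪
        s'.image (fun d : (ι ×ₗ ι) ×ₗ ι => (ofLex (ofLex d).1).2)))) :
    ((sectionsSystem (WΔ' A WΔ) (unitModule A.X.left) (ρ₁ A)).map (homOfLE hst)).hom ((ψΔ A U WΔ hWΔ s').hom x) =
      (ψΔ A U WΔ hWΔ t').hom (((sectionsSystem (U' A U) (unitModule A.X.left) (ρ₁ A)).map (homOfLE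
        (Finset.union_subset_union (Finset.image_subset_image hst) (Finset.image_subset_image hst)))).hom x) := by
  rw [sectionsSystem_map_apply, sectionsSystem_map_apply, ψΔ_apply, ψΔ_apply, SecMod.res_res, SecMod.res_res]

omit [CharZero k] [Fintype ι] in
/-- The data of `ref₁` factor through `ψΔ`. [cite: MumfordAV1970, §13 Cor. 2 (p. 129)] -/
theorem φref₁_eq_ψΔ (s' : Finset ((ι ×ₗ ι) ×ₗ ι))
    (x : SecMod (unitModule A.X.left) (ρ₁ A) (cechOpen (U' A U) (s'.image (fun d : (ι ×ₗ ι) ×ₗ ι => (ofLex (ofLex d).1).1)))) :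
    ((φref₁ A U WΔ hWΔ).app s').hom x = (ψΔ A U WΔ hWΔ s').hom
      (((sectionsSystem (U' A U) (unitModule A.X.left) (ρ₁ A)).map (homOfLE Finset.subset_union_left)).hom x) := by
  rw [sectionsSystem_map_apply, ψΔ_apply, SecMod.res_res]
  apply SecMod.toRing_injective (ρ₁ A)
  rw [toRing_pullbackSystemHom_id, SecMod.toRing_res]
  rfl

omit [CharZero k] [Fintype ι] in
/-- The data of `ref₂` factor through `ψΔ`. [cite: MumfordAV1970, §13 Cor. 2 (p. 129)] -/
theorem φref₂_eq_ψΔ (s' : Finset ((ι ×ₗ ι) ×ₗ ι))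
    (x : SecMod (unitModule A.X.left) (ρ₁ A) (cechOpen (U' A U) (s'.image (fun d : (ι ×ₗ ι) ×ₗ ι => (ofLex (ofLex d).1).2)))) :
    ((φref₂ A U WΔ hWΔ).app s').hom x = (ψΔ A U WΔ hWΔ s').hom
      (((sectionsSystem (U' A U) (unitModule A.X.left) (ρ₁ A)).map (homOfLE Finset.subset_union_right)).hom x) := by
  rw [sectionsSystem_map_apply, ψΔ_apply, SecMod.res_res]
  apply SecMod.toRing_injective (ρ₁ A)
  rw [toRing_pullbackSystemHom_id, SecMod.toRing_res]
  rfl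

omit [CharZero k] [Fintype ι] in
/-- **`ref₁ = ref₂ : Ȟⁿ(U) → Ȟⁿ(WΔ)`** — two admissible index maps for the same refinement induce the same map on classes
(★ B-p10 `homologyMap_eq_of_refine`, joint datum `ψΔ`). [cite: StacksProject, Tag 01FP] -/
theorem refΔ₁_eq_refΔ₂ (n : ℕ) (y : (CA A U).homology (n : ℤ)) :
    refΔ₁ A U WΔ hWΔ n y = refΔ₂ A U WΔ hWΔ n y :=
  congrArg (fun F => F.hom y)
    (homologyMap_eq_of_refine (fun d : (ι ×ₗ ι) ×ₗ ι => (ofLex (ofLex d).1).1)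
      (fun d : (ι ×ₗ ι) ×ₗ ι => (ofLex (ofLex d).1).2) (fun s' => (ψΔ A U WΔ hWΔ s').hom)
      (fun _ _ hst x => ψΔ_naturality A U WΔ hWΔ hst x) (φref₁ A U WΔ hWΔ) (φref₂ A U WΔ hWΔ)
      (φref₁_eq_ψΔ A U WΔ hWΔ) (φref₂_eq_ψΔ A U WΔ hWΔ)
      (refineComplexMap _ (φref₁ A U WΔ hWΔ)) (refineComplexMap _ (φref₂ A U WΔ hWΔ))
      (fun _ _ => rfl) (fun _ _ => rfl) (n : ℤ))

/-! ### Multiplicativity of `[2]^*` and of `ref₁` on classes -/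

omit [CharZero k] in
include hcov in
/-- `[2]^*` is multiplicative on classes (NON-monotone index map; ★ `homologyMap_pullback_cupH`). [cite: StacksProject, Tag 01FP] -/
theorem twoΔ_mul (a b n : ℕ) (h : a + b = n) (y : (CA A U).homology (a : ℤ)) (z : (CA A U).homology (b : ℤ)) :
    twoΔ A U WΔ hWΔ n (cupA A U a b n h y z) = cupΔ A WΔ a b n h (twoΔ A U WΔ hWΔ a y) (twoΔ A U WΔ hWΔ b z) :=
  homologyMap_pullback_cupH _ _ _ _ _ _ _ _ (hUa A U) hcov a b n h y z

omit [CharZero k] in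
include hcov in
/-- `ref₁` is multiplicative on classes. [cite: StacksProject, Tag 01FP] -/
theorem refΔ₁_mul (a b n : ℕ) (h : a + b = n) (y : (CA A U).homology (a : ℤ)) (z : (CA A U).homology (b : ℤ)) :
    refΔ₁ A U WΔ hWΔ n (cupA A U a b n h y z) = cupΔ A WΔ a b n h (refΔ₁ A U WΔ hWΔ a y) (refΔ₁ A U WΔ hWΔ b z) :=
  homologyMap_pullback_cupH _ _ _ _ _ _ _ _ (hUa A U) hcov a b n h y z


end MulTwo

/-! ### The auxiliary covers of `A × A` (★ `Morphisms/ProductAffineCover`) -/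

section Covers

variable {k : Type} [Field k] [CharZero k] (A : AbelianSchemeOver (Spec (.of k)))
  {ι : Type} [LinearOrder ι] [Fintype ι] (U : ι → A.X.left.affineOpens) (hcov : ⨆ i, (U i).1 = ⊤)
  (WΔ : (ι ×ₗ ι) ×ₗ ι → A.X.left.affineOpens)
  (hWΔ : ∀ i j l, (WΔ (toLex (toLex (i, j), l))).1 = (U i).1 ⊓ (U j).1 ⊓ mulTwo A ⁻¹ᵁ (U l).1)

omit [CharZero k] [LinearOrder ι] [Fintype ι] in
include hcov in
/-- The auxiliary covers `W₀`, `W`, `j₀` exist. [cite: StacksProject, Tag 01FP] -/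
theorem exists_covers : ∃ (W₀ : ι ×ₗ ι → (X2 A).affineOpens)
    (_ : ∀ i j, (W₀ (toLex (i, j))).1 = p₁ A ⁻¹ᵁ (U i).1 ⊓ p₂ A ⁻¹ᵁ (U j).1)
    (W : (ι ×ₗ ι) ×ₗ ι → (X2 A).affineOpens) (_ : ∀ c l, (W (toLex (c, l))).1 = (W₀ c).1 ⊓ m A ⁻¹ᵁ (U l).1)
    (j₀ : ι), e A ⁻¹ᵁ (U j₀).1 = ⊤ := by
  haveI : IsSeparated A.X.hom := A.isProper.toIsSeparated
  obtain ⟨W₀, hW₀⟩ := exists_productCover A.X A.X U U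
  obtain ⟨W, hW⟩ := exists_tripleCover W₀ (m A) U
  obtain ⟨j₀, hj₀⟩ : ∃ j₀ : ι, e A ⁻¹ᵁ (U j₀).1 = ⊤ := by
    haveI : Subsingleton ↥((𝟙_ (Over (Spec (CommRingCat.of k)))).left) :=
      inferInstanceAs (Subsingleton (PrimeSpectrum k))
    let y₀ : ↥((𝟙_ (Over (Spec (CommRingCat.of k)))).left) := (⊥ : PrimeSpectrum k)
    have hx : (e A).base y₀ ∈ (⊤ : A.X.left.Opens) := trivial
    rw [← hcov] at hx
    obtain ⟨j₀, hj⟩ := Opens.mem_iSup.mp hx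
    refine ⟨j₀, top_le_iff.mp fun y _ => ?_⟩
    have hy : y = y₀ := Subsingleton.elim _ _
    rw [hy]
    exact hj
  exact ⟨W₀, hW₀, W, hW, j₀, hj₀⟩


end Covers

end Literature.AlgebraicGeometry.AbelianSchemes.AbelianVarietyCech

end
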